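import Summits.Langlands.Langlands.Theorems.SqrtFiveQuarticCoversCertB3E7

/-!
# Route `Langlands/SqrtFiveQuarticCovers`, certificate `CertB3E7` (sheet 4.5, carrier `X(b3,e7)`) —
# the chart at infinity of `X(e7) × X(e7)` IN THE KERNEL: `CertB3E7` from the WEAKER model
# identification NF-K1-E10∞ (cell `pub/lg-quartmod`, F-L1; typ-2 prover re-seat; CONDITIONAL)

Companion to `Theorems/SqrtFiveQuarticCoversCertB3E7.lean` (p670569; ref-2 AUDIT-CertB3E7
d57dc21903fd595f), which stays untouched (a Theorems file is ≤ 400 lines, so this is a separate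
module rather than an append).  There, the model identification `hK1` (NF-K1-E10) EXCLUDES the case
«`E/C₃` lands on a point at infinity of `X(e7)`» by a prose step — E10-TWIN row 6 «chart at
infinity: `ℚ(P) = ℚ(√3,√7)` OUT», certnum RELEASES l.142, ref-2's audit §3: a `K`-point at infinity
of `y² = 7q(x) = 112x⁴ + …` needs `√7 ∈ K` (`(y/4x²)² = 112/16 = 7` there), and `(x₁, ∞) ∈ Ȳ_x`
needs the `x₂⁴`-coefficient `(3x₁²+6x₁+2)²` of `Ψ₃` to vanish, i.e. `(3x₁+3)² = 3`, `√3 ∈ K`;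
jointly `K ⊇ ℚ(√3,√5,√7)` of degree `8 > 4`.

Here that step is PROVED: in a quartic number field `K ∋ r`, `r² = 5`, there are no `s, z` with
`s² = 3 ∧ z² = 7` (`false_of_sq_eq_three_of_sq_eq_seven`; via the quadratic automorphism `σ` of
`K/ℚ(r)` from `exists_ringHom_ne_id_fixing_sqrt_five`: `σ s = ±s`, `σ z = ±z`, so one of `s, z, sz`
is `σ`-fixed, hence `a + b·r` with `a b : ℚ`, and `(a + b r)² = n ∈ {3, 7, 21}` forces `n` or `5n`
to be a perfect square, or `r ∈ ℚ` — all absurd).  Consequently the WEAKER hypothesis `hK1inf`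
(= `hK1` with the chart at infinity as an honest THIRD disjunct, so that the model identification
asserts nothing but «printed model of `X(e7)` [FLS Lemma 4.2, p. 28] + the `Ψ₃`-correspondence, in
every chart») implies `hK1` over the quartic fields in scope (`modelIdentificationB3E7_of_inf`), and
`certB3E7_of_modelIdentification_inf_of_census (hK1inf) (hE49) (hZmm) (hZmi) : CertB3E7` BY NAME.
Named input of record for asm-plan / the Record file: «ModelIdentificationB3E7Inf» = the type of
`hK1inf` (weaker than «ModelIdentificationB3E7»); «MordellWeilE7», «CensusMM», «CensusMI» unchanged
(hypothesis texts byte-identical to p670569's).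

HONEST STATUS: conditional bookkeeping; one prose exclusion replaced by a kernel proof; the named
inputs (model identification, rank-`0` datum resting on Kolyvagin–Logachev, certified census on the
lineages eng-8 27124f46183f2158 / eng-3 74120e68cc47c051 / certnum l.140–l.142 / eng-1 E10X
21347fd33ceba04b) are hypotheses, not theorems; «a certified finite datum is not a modularity
statement»; nothing here proves modularity of a new class of elliptic curves.
References: [FreitasLeHungSiksek2015] Lemma 4.2, p. 28 (arXiv:1310.7088); [Box2022] §1.1, Thm. 7.1.
-/

set_option linter.dupNamespace false -- project-wide option (lakefile weak.linter.dupNamespace); `Summit.Langlands.Langlands` is the mandated namespace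

namespace Summit.Langlands.Langlands.Theorems.SqrtFiveQuarticCovers

open scoped Matrix

/-! ## 1. No `√3 ∧ √7` in a quartic field containing `√5` -/

/-- `k² < n < (k+1)²` ⇒ `n` is not a perfect square. [folklore] -/
private theorem not_isSquare_of_sq_lt_of_lt_sq {n k : ℕ} (h1 : k ^ 2 < n) (h2 : n < (k + 1) ^ 2) :
    ¬ IsSquare n := by
  rintro ⟨m, rfl⟩
  have hkm : k < m := by nlinarith
  have hmk : m < k + 1 := by nlinarith
  omega

/-- In a field of characteristic `0` containing `r` with `r² = 5`: if `(a + b·r)² = n` with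
`a b : ℚ`, `n : ℕ`, then `n` or `5n` is a perfect square (if `ab ≠ 0` then `r ∈ ℚ`, impossible
since `5` is not a square; if `a = 0` then `(5b)² = 5n`; if `b = 0` then `a² = n`). [folklore] -/
theorem isSquare_or_isSquare_five_mul_of_sq_eq {K : Type} [Field K] [CharZero K] {r : K}
    (hr : r ^ 2 = 5) {a b : ℚ} {n : ℕ} (h : ((a : K) + (b : K) * r) ^ 2 = (n : K)) :
    IsSquare n ∨ IsSquare (5 * n) := by
  have hexp : (a : K) ^ 2 + 5 * (b : K) ^ 2 + 2 * (a : K) * (b : K) * r = (n : K) := by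
    rw [← h]; linear_combination -((b : K) ^ 2) * hr
  by_cases hab : a * b = 0
  · rcases mul_eq_zero.1 hab with ha | hb
    · -- `a = 0`: `5 b² = n`, so `(5b)² = 5n`
      right
      subst ha
      have hK : ((5 * b * (5 * b) : ℚ) : K) = (((5 * n : ℕ) : ℚ) : K) := by
        push_cast at hexp ⊢; linear_combination 5 * hexp
      exact Rat.isSquare_natCast_iff.1 ⟨5 * b, (Rat.cast_injective hK).symm⟩
    · -- `b = 0`: `a² = n`
      left
      subst hb
      have hK : ((a * a : ℚ) : K) = (((n : ℕ) : ℚ) : K) := by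
        push_cast at hexp ⊢; linear_combination hexp
      exact Rat.isSquare_natCast_iff.1 ⟨a, (Rat.cast_injective hK).symm⟩
  · -- `ab ≠ 0`: then `r = (n − a² − 5b²)/(2ab)` is rational, contradicting `r² = 5`
    exfalso
    have ha : a ≠ 0 := fun ha => hab (by rw [ha, zero_mul])
    have hb : b ≠ 0 := fun hb => hab (by rw [hb, mul_zero])
    have hab' : (2 * (a : K) * (b : K)) ≠ 0 := by
      have : ((2 * a * b : ℚ) : K) ≠ 0 := by
        rw [Ne, Rat.cast_eq_zero]; exact mul_ne_zero (mul_ne_zero two_ne_zero ha) hb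
      push_cast at this; exact this
    set q : ℚ := ((n : ℚ) - a ^ 2 - 5 * b ^ 2) / (2 * a * b) with hq
    have hrq : r = (q : K) := by
      rw [hq]; push_cast; rw [eq_div_iff hab']; linear_combination hexp
    have h5 : ((q * q : ℚ) : K) = (((5 : ℕ) : ℚ) : K) := by
      push_cast; rw [← hrq, ← sq, hr]
    have : IsSquare (5 : ℕ) := Rat.isSquare_natCast_iff.1 ⟨q, (Rat.cast_injective h5).symm⟩
    exact not_isSquare_of_sq_lt_of_lt_sq (k := 2) (by norm_num) (by norm_num) this

/-- **No `√3` and `√7` together in a quartic field containing `√5`.**  For `K` a quartic number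
field and `r s z ∈ K` with `r² = 5`, `s² = 3`, `z² = 7`: contradiction (`ℚ(√3,√5,√7)` has degree
`8`).  Kernel proof via the quadratic automorphism `σ` of `K/ℚ(r)`
(`exists_ringHom_ne_id_fixing_sqrt_five`): `σ s = ±s`, `σ z = ±z`; whichever of `s`, `z`, `s·z`
is `σ`-fixed lies in `ℚ + ℚ·r`, and `isSquare_or_isSquare_five_mul_of_sq_eq` with
`n ∈ {3, 7, 21}` leaves only perfect squares among `3, 15, 7, 35, 21, 105` — there are none.
This is the «chart at infinity» exclusion of NF-K1-E10 (E10-TWIN row 6; certnum RELEASES l.142).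
[folklore] -/
theorem false_of_sq_eq_three_of_sq_eq_seven {K : Type} [Field K] [NumberField K]
    (hd : Module.finrank ℚ K = 4) {r s z : K} (hr : r ^ 2 = 5) (hs : s ^ 2 = 3) (hz : z ^ 2 = 7) :
    False := by
  obtain ⟨σ, -, -, hfix⟩ := exists_ringHom_ne_id_fixing_sqrt_five hd hr
  -- `σ w = ± w` whenever `w² = n` with `n` fixed by `σ`
  have hpm : ∀ {w n : K}, σ n = n → w ^ 2 = n → σ w = w ∨ σ w = -w := by
    intro w n hn hw
    have h2 : (σ w) ^ 2 = w ^ 2 := by rw [← map_pow, hw, hn]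
    have h0 : (σ w - w) * (σ w + w) = 0 := by linear_combination h2
    rcases mul_eq_zero.1 h0 with h | h
    · exact Or.inl (sub_eq_zero.1 h)
    · exact Or.inr (eq_neg_of_add_eq_zero_left h)
  -- a `σ`-fixed square root of `n : ℕ` forces `n` or `5n` to be a perfect square
  have key : ∀ {w : K} {n : ℕ}, w ^ 2 = (n : K) → σ w = w → IsSquare n ∨ IsSquare (5 * n) := by
    intro w n hw hfixw
    obtain ⟨a, b, hab⟩ := hfix w hfixw
    rw [hab] at hw
    exact isSquare_or_isSquare_five_mul_of_sq_eq hr hw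
  have hs3 : s ^ 2 = ((3 : ℕ) : K) := by rw [hs]; norm_num
  have hz7 : z ^ 2 = ((7 : ℕ) : K) := by rw [hz]; norm_num
  rcases hpm (map_ofNat σ 3) hs with hs' | hs'
  · rcases key hs3 hs' with h | h
    · exact not_isSquare_of_sq_lt_of_lt_sq (k := 1) (by norm_num) (by norm_num) h
    · exact not_isSquare_of_sq_lt_of_lt_sq (k := 3) (by norm_num) (by norm_num) h
  rcases hpm (map_ofNat σ 7) hz with hz' | hz'
  · rcases key hz7 hz' with h | h
    · exact not_isSquare_of_sq_lt_of_lt_sq (k := 2) (by norm_num) (by norm_num) h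
    · exact not_isSquare_of_sq_lt_of_lt_sq (k := 5) (by norm_num) (by norm_num) h
  -- `σ s = -s`, `σ z = -z` ⇒ `s z` is fixed, `(s z)² = 21`
  have hsz : σ (s * z) = s * z := by rw [map_mul, hs', hz']; ring
  have hsz2 : (s * z) ^ 2 = ((21 : ℕ) : K) := by rw [mul_pow, hs, hz]; norm_num
  rcases key hsz2 hsz with h | h
  · exact not_isSquare_of_sq_lt_of_lt_sq (k := 4) (by norm_num) (by norm_num) h
  · exact not_isSquare_of_sq_lt_of_lt_sq (k := 10) (by norm_num) (by norm_num) h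

/-! ## 2. `CertB3E7` from the weaker model identification NF-K1-E10∞ -/

/-- **NF-K1-E10∞ ⇒ NF-K1-E10 over the quartic fields in scope.**  The WEAKER model identification
`hK1inf` — `hK1` with the honest third disjunct «`E/C₃` sits at a `K`-point at infinity of
`X(e7)`: `∃ x₁ y₁ z`, `(x₁,y₁)` affine on `y² = 7q(x)` with `D(x₁) ≠ 0`, `j(E)·D(x₁) = N(x₁)`,
`(x₁, ∞) ∈ Ȳ_x`, i.e. the `x₂⁴`-coefficient `(3x₁²+6x₁+2)²` of `Ψ₃` vanishes, and `z² = 7`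
(`(y/4x²)² = 112/16` at the two points at infinity of `y² = 112x⁴ + …`)» — implies `hK1` itself
for every quartic `K ∋ √5`: the third disjunct is empty there, since `(3x₁²+6x₁+2)² = 0` gives
`(3x₁+3)² = 3` and `false_of_sq_eq_three_of_sq_eq_seven` applies.  Kernel-checked replacement of
the prose step «E10-TWIN row 6 / certnum l.142: `ℚ(P) = ℚ(√3,√7)` OUT». [folklore]
[cite: FreitasLeHungSiksek2015, Lemma 4.2 (p. 28)] -/
theorem modelIdentificationB3E7_of_inf
    (hK1inf : ∀ (K : Type) [Field K] [NumberField K], Module.finrank ℚ K = 4 → (∃ r : K, r ^ 2 = 5) →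
        ∀ E : WeierstrassCurve (NumberField.RingOfIntegers K), E.Δ ≠ 0 →
          (∃ ρ : Literature.NumberTheory.GaloisRepresentations.FramedGaloisRep K (ZMod 3) 2, (∃ e : (E.baseChange K).geomTorsion ((3 : ℕ) : ℤ) ≃+ (Fin 2 → ZMod 3), ∀ (σ : Field.absoluteGaloisGroup K) (P : (E.baseChange K).geomTorsion ((3 : ℕ) : ℤ)), e (σ • P) = ((ρ σ : GL (Fin 2) (ZMod 3)) : Matrix (Fin 2) (Fin 2) (ZMod 3)) *ᵥ (e P)) ∧ ((∀ σ : Field.absoluteGaloisGroup K, (((ρ σ : GL (Fin 2) (ZMod 3)) : Matrix (Fin 2) (Fin 2) (ZMod 3)) 1 0 = 0)))) →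
          (∃ ρ : Literature.NumberTheory.GaloisRepresentations.FramedGaloisRep K (ZMod 7) 2, (∃ e : (E.baseChange K).geomTorsion ((7 : ℕ) : ℤ) ≃+ (Fin 2 → ZMod 7), ∀ (σ : Field.absoluteGaloisGroup K) (P : (E.baseChange K).geomTorsion ((7 : ℕ) : ℤ)), e (σ • P) = ((ρ σ : GL (Fin 2) (ZMod 7)) : Matrix (Fin 2) (Fin 2) (ZMod 7)) *ᵥ (e P)) ∧ ((∀ σ : Field.absoluteGaloisGroup K, (ρ σ : GL (Fin 2) (ZMod 7)) ∈ Subgroup.closure ({(⟨!![0, 5; 3, 0], !![0, 5; 3, 0], by decide, by decide⟩ : GL (Fin 2) (ZMod 7)), (⟨!![5, 0; 3, 2], !![3, 0; 6, 4], by decide, by decide⟩ : GL (Fin 2) (ZMod 7))} : Set (GL (Fin 2) (ZMod 7)))))) →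
          ((E.baseChange K).c₄ ^ 3 = 1728 * (E.baseChange K).Δ ∨
           (∃ x₁ y₁ x₂ y₂ : K, y₁ ^ 2 = 7 * (16 * x₁ ^ 4 + 68 * x₁ ^ 3 + 111 * x₁ ^ 2 + 62 * x₁ + 11) ∧ y₂ ^ 2 = 7 * (16 * x₂ ^ 4 + 68 * x₂ ^ 3 + 111 * x₂ ^ 2 + 62 * x₂ + 11) ∧
            ((x₁ ^ 3 + x₁ ^ 2 - 2 * x₁ - 1) ^ 7) ≠ 0 ∧
            (E.baseChange K).c₄ ^ 3 * ((x₁ ^ 3 + x₁ ^ 2 - 2 * x₁ - 1) ^ 7) = ((3 * x₁ + 1) ^ 3 * (4 * x₁ ^ 2 + 5 * x₁ + 2) ^ 3 * (x₁ ^ 2 + 3 * x₁ + 4) ^ 3 * (x₁ ^ 2 + 10 * x₁ + 4) ^ 3) * (E.baseChange K).Δ ∧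
            ((3 * x₂ ^ 2 + 6 * x₂ + 2) ^ 2 * x₁ ^ 4 + (36 * x₂ ^ 4 + 125 * x₂ ^ 3 + 138 * x₂ ^ 2 + 60 * x₂ + 9) * x₁ ^ 3 + (48 * x₂ ^ 4 + 138 * x₂ ^ 3 + 111 * x₂ ^ 2 + 33 * x₂ + 3) * x₁ ^ 2 + (24 * x₂ ^ 4 + 60 * x₂ ^ 3 + 33 * x₂ ^ 2 + 5 * x₂) * x₁ + (4 * x₂ ^ 4 + 9 * x₂ ^ 3 + 3 * x₂ ^ 2)) = 0) ∨
           (∃ x₁ y₁ z : K, y₁ ^ 2 = 7 * (16 * x₁ ^ 4 + 68 * x₁ ^ 3 + 111 * x₁ ^ 2 + 62 * x₁ + 11) ∧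
            ((x₁ ^ 3 + x₁ ^ 2 - 2 * x₁ - 1) ^ 7) ≠ 0 ∧
            (E.baseChange K).c₄ ^ 3 * ((x₁ ^ 3 + x₁ ^ 2 - 2 * x₁ - 1) ^ 7) = ((3 * x₁ + 1) ^ 3 * (4 * x₁ ^ 2 + 5 * x₁ + 2) ^ 3 * (x₁ ^ 2 + 3 * x₁ + 4) ^ 3 * (x₁ ^ 2 + 10 * x₁ + 4) ^ 3) * (E.baseChange K).Δ ∧
            (3 * x₁ ^ 2 + 6 * x₁ + 2) ^ 2 = 0 ∧ z ^ 2 = 7))) :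
    ∀ (K : Type) [Field K] [NumberField K], Module.finrank ℚ K = 4 → (∃ r : K, r ^ 2 = 5) →
        ∀ E : WeierstrassCurve (NumberField.RingOfIntegers K), E.Δ ≠ 0 →
          (∃ ρ : Literature.NumberTheory.GaloisRepresentations.FramedGaloisRep K (ZMod 3) 2, (∃ e : (E.baseChange K).geomTorsion ((3 : ℕ) : ℤ) ≃+ (Fin 2 → ZMod 3), ∀ (σ : Field.absoluteGaloisGroup K) (P : (E.baseChange K).geomTorsion ((3 : ℕ) : ℤ)), e (σ • P) = ((ρ σ : GL (Fin 2) (ZMod 3)) : Matrix (Fin 2) (Fin 2) (ZMod 3)) *ᵥ (e P)) ∧ ((∀ σ : Field.absoluteGaloisGroup K, (((ρ σ : GL (Fin 2) (ZMod 3)) : Matrix (Fin 2) (Fin 2) (ZMod 3)) 1 0 = 0)))) →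
          (∃ ρ : Literature.NumberTheory.GaloisRepresentations.FramedGaloisRep K (ZMod 7) 2, (∃ e : (E.baseChange K).geomTorsion ((7 : ℕ) : ℤ) ≃+ (Fin 2 → ZMod 7), ∀ (σ : Field.absoluteGaloisGroup K) (P : (E.baseChange K).geomTorsion ((7 : ℕ) : ℤ)), e (σ • P) = ((ρ σ : GL (Fin 2) (ZMod 7)) : Matrix (Fin 2) (Fin 2) (ZMod 7)) *ᵥ (e P)) ∧ ((∀ σ : Field.absoluteGaloisGroup K, (ρ σ : GL (Fin 2) (ZMod 7)) ∈ Subgroup.closure ({(⟨!![0, 5; 3, 0], !![0, 5; 3, 0], by decide, by decide⟩ : GL (Fin 2) (ZMod 7)), (⟨!![5, 0; 3, 2], !![3, 0; 6, 4], by decide, by decide⟩ : GL (Fin 2) (ZMod 7))} : Set (GL (Fin 2) (ZMod 7)))))) →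
          ((E.baseChange K).c₄ ^ 3 = 1728 * (E.baseChange K).Δ ∨
           ∃ x₁ y₁ x₂ y₂ : K, y₁ ^ 2 = 7 * (16 * x₁ ^ 4 + 68 * x₁ ^ 3 + 111 * x₁ ^ 2 + 62 * x₁ + 11) ∧ y₂ ^ 2 = 7 * (16 * x₂ ^ 4 + 68 * x₂ ^ 3 + 111 * x₂ ^ 2 + 62 * x₂ + 11) ∧
            ((x₁ ^ 3 + x₁ ^ 2 - 2 * x₁ - 1) ^ 7) ≠ 0 ∧
            (E.baseChange K).c₄ ^ 3 * ((x₁ ^ 3 + x₁ ^ 2 - 2 * x₁ - 1) ^ 7) = ((3 * x₁ + 1) ^ 3 * (4 * x₁ ^ 2 + 5 * x₁ + 2) ^ 3 * (x₁ ^ 2 + 3 * x₁ + 4) ^ 3 * (x₁ ^ 2 + 10 * x₁ + 4) ^ 3) * (E.baseChange K).Δ ∧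
            ((3 * x₂ ^ 2 + 6 * x₂ + 2) ^ 2 * x₁ ^ 4 + (36 * x₂ ^ 4 + 125 * x₂ ^ 3 + 138 * x₂ ^ 2 + 60 * x₂ + 9) * x₁ ^ 3 + (48 * x₂ ^ 4 + 138 * x₂ ^ 3 + 111 * x₂ ^ 2 + 33 * x₂ + 3) * x₁ ^ 2 + (24 * x₂ ^ 4 + 60 * x₂ ^ 3 + 33 * x₂ ^ 2 + 5 * x₂) * x₁ + (4 * x₂ ^ 4 + 9 * x₂ ^ 3 + 3 * x₂ ^ 2)) = 0) := by
  intro K _ _ hd hr5 E hΔ h3 h7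
  obtain ⟨r, hr⟩ := hr5
  rcases hK1inf K hd ⟨r, hr⟩ E hΔ h3 h7 with h | h | ⟨x₁, -, z, -, -, -, hlead, hz⟩
  · exact Or.inl h
  · exact Or.inr h
  · exfalso
    have hq : 3 * x₁ ^ 2 + 6 * x₁ + 2 = 0 := (pow_eq_zero_iff two_ne_zero).1 hlead
    have hs : (3 * x₁ + 3) ^ 2 = 3 := by linear_combination 3 * hq
    exact false_of_sq_eq_three_of_sq_eq_seven hd hr hs hz

set_option maxHeartbeats 1000000 in -- five written-out hypothesis types with `decide`d matrix entries; statement elaboration only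
/-- **`CertB3E7` BY NAME from the WEAKER model identification NF-K1-E10∞** (`hK1inf`: printed
model of `X(e7)` + `Ψ₃`-correspondence in EVERY chart, the chart at infinity included as a third
disjunct and killed in the kernel by `false_of_sq_eq_three_of_sq_eq_seven`), NF-E10-MW (`hE49`) and
the certified census NF-E10-ZDS (`hZmm`, `hZmi`; lineages eng-8 E10-REPORT 27124f46183f2158, eng-3
E10-TWIN 74120e68cc47c051, certnum RELEASES l.140–l.142 (RQ-027 CLOSED), eng-1 E10X
21347fd33ceba04b method-disjoint; ref-2 AUDIT-CertB3E7 d57dc21903fd595f): `certB3E7` composed with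
`modelIdentificationB3E7_of_inf`.  CONDITIONAL on the four hypotheses; the item
stmt-Langlands-23416 stays open modulo these named inputs («ModelIdentificationB3E7Inf»,
«MordellWeilE7», «CensusMM», «CensusMI»); «a certified finite datum is not a modularity
statement»; nothing here proves modularity of a new class.
[cite: FreitasLeHungSiksek2015, Lemma 4.2 (p. 28)] [cite: Box2022, §1.1 and Thm. 7.1] -/
theorem certB3E7_of_modelIdentification_inf_of_census
    (hK1inf : ∀ (K : Type) [Field K] [NumberField K], Module.finrank ℚ K = 4 → (∃ r : K, r ^ 2 = 5) →
        ∀ E : WeierstrassCurve (NumberField.RingOfIntegers K), E.Δ ≠ 0 →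
          (∃ ρ : Literature.NumberTheory.GaloisRepresentations.FramedGaloisRep K (ZMod 3) 2, (∃ e : (E.baseChange K).geomTorsion ((3 : ℕ) : ℤ) ≃+ (Fin 2 → ZMod 3), ∀ (σ : Field.absoluteGaloisGroup K) (P : (E.baseChange K).geomTorsion ((3 : ℕ) : ℤ)), e (σ • P) = ((ρ σ : GL (Fin 2) (ZMod 3)) : Matrix (Fin 2) (Fin 2) (ZMod 3)) *ᵥ (e P)) ∧ ((∀ σ : Field.absoluteGaloisGroup K, (((ρ σ : GL (Fin 2) (ZMod 3)) : Matrix (Fin 2) (Fin 2) (ZMod 3)) 1 0 = 0)))) →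
          (∃ ρ : Literature.NumberTheory.GaloisRepresentations.FramedGaloisRep K (ZMod 7) 2, (∃ e : (E.baseChange K).geomTorsion ((7 : ℕ) : ℤ) ≃+ (Fin 2 → ZMod 7), ∀ (σ : Field.absoluteGaloisGroup K) (P : (E.baseChange K).geomTorsion ((7 : ℕ) : ℤ)), e (σ • P) = ((ρ σ : GL (Fin 2) (ZMod 7)) : Matrix (Fin 2) (Fin 2) (ZMod 7)) *ᵥ (e P)) ∧ ((∀ σ : Field.absoluteGaloisGroup K, (ρ σ : GL (Fin 2) (ZMod 7)) ∈ Subgroup.closure ({(⟨!![0, 5; 3, 0], !![0, 5; 3, 0], by decide, by decide⟩ : GL (Fin 2) (ZMod 7)), (⟨!![5, 0; 3, 2], !![3, 0; 6, 4], by decide, by decide⟩ : GL (Fin 2) (ZMod 7))} : Set (GL (Fin 2) (ZMod 7)))))) →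
          ((E.baseChange K).c₄ ^ 3 = 1728 * (E.baseChange K).Δ ∨
           (∃ x₁ y₁ x₂ y₂ : K, y₁ ^ 2 = 7 * (16 * x₁ ^ 4 + 68 * x₁ ^ 3 + 111 * x₁ ^ 2 + 62 * x₁ + 11) ∧ y₂ ^ 2 = 7 * (16 * x₂ ^ 4 + 68 * x₂ ^ 3 + 111 * x₂ ^ 2 + 62 * x₂ + 11) ∧
            ((x₁ ^ 3 + x₁ ^ 2 - 2 * x₁ - 1) ^ 7) ≠ 0 ∧
            (E.baseChange K).c₄ ^ 3 * ((x₁ ^ 3 + x₁ ^ 2 - 2 * x₁ - 1) ^ 7) = ((3 * x₁ + 1) ^ 3 * (4 * x₁ ^ 2 + 5 * x₁ + 2) ^ 3 * (x₁ ^ 2 + 3 * x₁ + 4) ^ 3 * (x₁ ^ 2 + 10 * x₁ + 4) ^ 3) * (E.baseChange K).Δ ∧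
            ((3 * x₂ ^ 2 + 6 * x₂ + 2) ^ 2 * x₁ ^ 4 + (36 * x₂ ^ 4 + 125 * x₂ ^ 3 + 138 * x₂ ^ 2 + 60 * x₂ + 9) * x₁ ^ 3 + (48 * x₂ ^ 4 + 138 * x₂ ^ 3 + 111 * x₂ ^ 2 + 33 * x₂ + 3) * x₁ ^ 2 + (24 * x₂ ^ 4 + 60 * x₂ ^ 3 + 33 * x₂ ^ 2 + 5 * x₂) * x₁ + (4 * x₂ ^ 4 + 9 * x₂ ^ 3 + 3 * x₂ ^ 2)) = 0) ∨
           (∃ x₁ y₁ z : K, y₁ ^ 2 = 7 * (16 * x₁ ^ 4 + 68 * x₁ ^ 3 + 111 * x₁ ^ 2 + 62 * x₁ + 11) ∧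
            ((x₁ ^ 3 + x₁ ^ 2 - 2 * x₁ - 1) ^ 7) ≠ 0 ∧
            (E.baseChange K).c₄ ^ 3 * ((x₁ ^ 3 + x₁ ^ 2 - 2 * x₁ - 1) ^ 7) = ((3 * x₁ + 1) ^ 3 * (4 * x₁ ^ 2 + 5 * x₁ + 2) ^ 3 * (x₁ ^ 2 + 3 * x₁ + 4) ^ 3 * (x₁ ^ 2 + 10 * x₁ + 4) ^ 3) * (E.baseChange K).Δ ∧
            (3 * x₁ ^ 2 + 6 * x₁ + 2) ^ 2 = 0 ∧ z ^ 2 = 7)))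
        (hE49 : ∀ (K : Type) [Field K] [NumberField K], Module.finrank ℚ K = 4 → ∀ r : K, r ^ 2 = 5 →
        ∀ σ : K →+* K, σ r = r → σ ≠ RingHom.id K →
          ∀ x y : K, y ^ 2 = 7 * (16 * x ^ 4 + 68 * x ^ 3 + 111 * x ^ 2 + 62 * x + 11) → (σ x = x ∨ (12 * x + 5) * σ x = -(5 * x + 2)))
        (hZmm : ∀ (K : Type) [Field K] [NumberField K], Module.finrank ℚ K = 4 → (∃ r : K, r ^ 2 = 5) →
        ∀ x₁ y₁ x₂ x₁' x₂' : K, y₁ ^ 2 = 7 * (16 * x₁ ^ 4 + 68 * x₁ ^ 3 + 111 * x₁ ^ 2 + 62 * x₁ + 11) →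
          ((3 * x₂ ^ 2 + 6 * x₂ + 2) ^ 2 * x₁ ^ 4 + (36 * x₂ ^ 4 + 125 * x₂ ^ 3 + 138 * x₂ ^ 2 + 60 * x₂ + 9) * x₁ ^ 3 + (48 * x₂ ^ 4 + 138 * x₂ ^ 3 + 111 * x₂ ^ 2 + 33 * x₂ + 3) * x₁ ^ 2 + (24 * x₂ ^ 4 + 60 * x₂ ^ 3 + 33 * x₂ ^ 2 + 5 * x₂) * x₁ + (4 * x₂ ^ 4 + 9 * x₂ ^ 3 + 3 * x₂ ^ 2)) = 0 →
          (12 * x₁ + 5) * x₁' = -(5 * x₁ + 2) → (12 * x₂ + 5) * x₂' = -(5 * x₂ + 2) →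
          ((3 * x₂' ^ 2 + 6 * x₂' + 2) ^ 2 * x₁' ^ 4 + (36 * x₂' ^ 4 + 125 * x₂' ^ 3 + 138 * x₂' ^ 2 + 60 * x₂' + 9) * x₁' ^ 3 + (48 * x₂' ^ 4 + 138 * x₂' ^ 3 + 111 * x₂' ^ 2 + 33 * x₂' + 3) * x₁' ^ 2 + (24 * x₂' ^ 4 + 60 * x₂' ^ 3 + 33 * x₂' ^ 2 + 5 * x₂') * x₁' + (4 * x₂' ^ 4 + 9 * x₂' ^ 3 + 3 * x₂' ^ 2)) = 0 →
          (3 * x₁ + 1 = 0 ∨ x₁ ^ 2 + 10 * x₁ + 4 = 0))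
        (hZmi : ∀ (K : Type) [Field K] [NumberField K], Module.finrank ℚ K = 4 → (∃ r : K, r ^ 2 = 5) →
        ∀ x₁ y₁ x₂ x₁' : K, y₁ ^ 2 = 7 * (16 * x₁ ^ 4 + 68 * x₁ ^ 3 + 111 * x₁ ^ 2 + 62 * x₁ + 11) →
          ((3 * x₂ ^ 2 + 6 * x₂ + 2) ^ 2 * x₁ ^ 4 + (36 * x₂ ^ 4 + 125 * x₂ ^ 3 + 138 * x₂ ^ 2 + 60 * x₂ + 9) * x₁ ^ 3 + (48 * x₂ ^ 4 + 138 * x₂ ^ 3 + 111 * x₂ ^ 2 + 33 * x₂ + 3) * x₁ ^ 2 + (24 * x₂ ^ 4 + 60 * x₂ ^ 3 + 33 * x₂ ^ 2 + 5 * x₂) * x₁ + (4 * x₂ ^ 4 + 9 * x₂ ^ 3 + 3 * x₂ ^ 2)) = 0 →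
          (12 * x₁ + 5) * x₁' = -(5 * x₁ + 2) →
          ((3 * x₂ ^ 2 + 6 * x₂ + 2) ^ 2 * x₁' ^ 4 + (36 * x₂ ^ 4 + 125 * x₂ ^ 3 + 138 * x₂ ^ 2 + 60 * x₂ + 9) * x₁' ^ 3 + (48 * x₂ ^ 4 + 138 * x₂ ^ 3 + 111 * x₂ ^ 2 + 33 * x₂ + 3) * x₁' ^ 2 + (24 * x₂ ^ 4 + 60 * x₂ ^ 3 + 33 * x₂ ^ 2 + 5 * x₂) * x₁' + (4 * x₂ ^ 4 + 9 * x₂ ^ 3 + 3 * x₂ ^ 2)) = 0 →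
          3 * x₁ + 1 = 0) :
    Summit.Langlands.Langlands.Theses.SqrtFiveQuarticCovers.CertB3E7 :=
  certB3E7 (modelIdentificationB3E7_of_inf hK1inf) hE49 hZmm hZmi

end Summit.Langlands.Langlands.Theorems.SqrtFiveQuarticCovers
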